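import Literature.Topology.FourManifolds.LevelFeetSymmetry
import Literature.Topology.FourManifolds.OpensBoundaryInclusion
import Literature.Topology.FourManifolds.HandleFeet
import Literature.Topology.FourManifolds.OrientedConnectedSumSphereSelf
import Literature.Topology.FourManifolds.HandlebodyClassificationProofs
import Literature.Topology.FourManifolds.SmoothOrientationConnectedProofs
import Literature.Topology.FourManifolds.LevelEmbedding
import HarnessLib

/-!
# The two feet of a `1`-handle have opposite orientation characters in the level below it

Topic `Literature/Topology/FourManifolds` (fact seat
`provefact-Literature.Topology.FourManifolds.IsHandlebody.exists_diffeomorph_isBoundaryGluing_sphere`,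
step F2b₁ of the Lickorish–Wallace DAG; orientation bookkeeping of the level-preserving
handle-extension step to which L1 `oneHandle_nonempty_diffeomorph` is reduced in
`HandleAttachmentNormalisation.lean`).  Everything here is **proved**; no named facts.

§1 **The model.**  On the open ball `B(c₀, R) ⊂ ℝⁿ⁺¹` (an open submanifold) the function
`g = b + Q₁(· - c₀)`, `Q₁(u) = -u₀² + ‖y‖²` Milnor's quadratic form of index `1`, has the
regular level `b - m` (`m > 0`); the **reflection** `(u₀, y) ↦ (-u₀, y)` about `c₀`
(`OneHandleModel.refl`, from Mathlib's hyperplane reflection) preserves `g`, exchanges the two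
model feet `w ↦ c₀ + footModel (±1) m ρ w` of `HandleFeet.lean` (`refl_footB`), and **reverses
every orientation of the ball** (`refl_isOrientationReversing`: its differential at the fixed
centre is the reflection, of determinant `-1`; Hirsch (1976), Ch. 4 §4, p. 105, and the
dichotomy for diffeomorphisms of a connected manifold).  By `LevelFeetSymmetry.lean` the lifts of
the two model feet to the level manifold `∂{g ≤ b - m}` therefore have opposite orientation
characters for the boundary orientation induced by any orientation of the ball.

§2 **Transfer to a handle chart.**  For a `HandleChart D` of index `1` at `p` (Morse chart `φ̂`
with `f = f p + Q₁ ∘ (φ̂ - φ̂ p)`) whose closed chart ball of radius `R` lies in the chart target,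
the inverse chart `ψ = φ̂⁻¹ : B → M` is a local diffeomorphism with `f ∘ ψ = g` (`b = f p`).  With
the data bundled in `HandleChart.TransferData` (`f` smooth, `{f ≤ f p - m}` interior with regular
level and carrying the structure of `sublevelAtlas`, `D.k = 1`, `0 < m`, `1 ≤ n`, `0 < R`), `ψ`
induces a **global diffeomorphism** `{g ≤ f p - m} ∩ B ≅ {f ≤ f p - m} ∩ φ̂⁻¹(B)` onto an open
submanifold of the sublevel set (`TransferData.sublevelDiffeomorph`), preserving the orientations
pulled back from an orientation `oM` of `M` (`sublevelDiffeomorph_isOrientationPreserving`; Hirsch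
§4.4 p. 101), hence a diffeomorphism of the boundaries (`levelDiffeomorph`, via the
heterogeneous-universe restriction `Diffeomorph.toBoundaryDiffeomorph`) preserving the boundary
orientations (`Diffeomorph.isOrientationPreserving_boundaryMap`, Hirsch §4.4 p. 103), and with
the boundary inclusion of an open submanifold (`Opens.boundaryIncl`, identity differential) a
**transfer map** `∂({g ≤ f p - m} ∩ B) → ∂{f ≤ f p - m}` through which the lifted feet
`footLift (±1) = levelLift (D.foot (±1) m ρ)` of `HandleFeet.lean`/`LevelEmbedding.lean` factor
*definitionally* (`footLift_eq_comp`).  Cancelling the orientation-preserving transfer map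
(`IsOrientationPreserving.of_comp_left` / `comp_holds`) gives the main results:

* `TransferData.footLift_isOrientationPreserving_iff_neg` — for the boundary orientation `∂oN`
  induced from `oM`, the `+` foot preserves `(o₀, ∂oN)` iff the `−` foot preserves `(−o₀, ∂oN)`
  (Kosinski (1993), VI (6.6): "the two attaching spheres of a 1-handle inherit opposite
  orientations");
* `TransferData.footLift_isOrientationPreserving_iff_neg_of_connected` — the same for *every*
  orientation of a connected level (`oV = ±∂oN`, Hirsch §4.4).

## References

* A. A. Kosinski, *Differential Manifolds* (1993), VI (6.6), proof of VI (11.4)(c). [Kosinski1993]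
* M. W. Hirsch, *Differential Topology*, GTM 33 (1976), Ch. 4 §4, pp. 101–105. [HirschDT1976]
* J. Milnor, *Lectures on the h-cobordism theorem* (1965), Def. 3.1, proof of Thm. 3.13.
  [MilnorHCobordism1965]
-/

open scoped Manifold ContDiff Topology InnerProductSpace
open Set Function Module Metric

noncomputable section

namespace Literature.Topology.FourManifolds

universe u

/-- Local notation: `𝔼 n` is the model Euclidean space `EuclideanSpace ℝ (Fin n)`. -/
local notation "𝔼 " n:arg => EuclideanSpace ℝ (Fin n)

open BoundaryManifold

/-! ### §1 The model: ball, quadratic function, reflection, feet -/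

namespace OneHandleModel

variable (n : ℕ)

/-- The reflection `(u₀, y) ↦ (-u₀, y)` of `ℝⁿ⁺¹` in the hyperplane `{u₀ = 0}` (Mathlib's
`Submodule.reflection` of `(ℝ ∙ e₀)ᗮ`). [folklore] -/
def reflE : 𝔼 (n + 1) ≃L[ℝ] 𝔼 (n + 1) := ((ℝ ∙ e0 n)ᗮ).reflection.toContinuousLinearEquiv

/-- `e₀ (i+1) = 0`. [folklore] -/
theorem e0_apply_succ (i : Fin n) : e0 n i.succ = 0 := by
  rw [e0, consCLE_apply_succ]; rfl

/-- `‖e₀‖ = 1`. [folklore] -/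
theorem norm_e0 : ‖e0 n‖ = 1 := by
  have h : ‖e0 n‖ ^ 2 = 1 := by
    rw [e0, norm_consCLE_sq]; simp
  nlinarith [norm_nonneg (e0 n)]

/-- `e₀ ≠ 0`. [folklore] -/
theorem e0_ne_zero : e0 n ≠ 0 := by
  intro h; have := congrArg (fun v : 𝔼 (n + 1) => v 0) h
  rw [e0_apply_zero] at this; simp at this

/-- `⟪e₀, u⟫ = u 0`. [folklore] -/
theorem inner_e0_left (u : 𝔼 (n + 1)) : ⟪e0 n, u⟫_ℝ = u 0 := by
  rw [← consCLE_tail n u]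
  set p : 𝔼 n × ℝ := (tail n u, u 0)
  have h1 : e0 n = consCLE n (0, 1) := rfl
  rw [h1]
  -- expand both in coordinates
  rw [EuclideanSpace.inner_eq_star_dotProduct]
  simp only [star_trivial, dotProduct, Fin.sum_univ_succ, consCLE_apply_zero, consCLE_apply_succ]
  simp

/-- The reflection in coordinates: `R u = u - 2 u₀ e₀`. [folklore] -/
theorem reflE_apply (u : 𝔼 (n + 1)) : reflE n u = u - (2 * u 0) • e0 n := by
  show ((ℝ ∙ e0 n)ᗮ).reflection u = _
  rw [Submodule.reflection_orthogonal_apply, Submodule.reflection_singleton_apply, norm_e0, inner_e0_left]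
  simp only [RCLike.ofReal_one, one_pow, div_one]
  module

/-- The reflection on `consCLE (y, t)`: `(y, t) ↦ (y, -t)`. [folklore] -/
theorem reflE_consCLE (y : 𝔼 n) (t : ℝ) : reflE n (consCLE n (y, t)) = consCLE n (y, -t) := by
  rw [reflE_apply, consCLE_apply_zero]
  have : consCLE n (y, -t) = consCLE n (y, t) - (2 * t) • consCLE n ((0 : 𝔼 n), (1 : ℝ)) := by
    rw [← map_smul, ← map_sub]; congr 1; ext <;> simp; ring
  rw [this]; rfl

/-- The `0`-th coordinate is negated. [folklore] -/
theorem reflE_apply_zero (u : 𝔼 (n + 1)) : reflE n u 0 = -u 0 := by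
  rw [← consCLE_tail n u, reflE_consCLE, consCLE_apply_zero, consCLE_apply_zero]

/-- The tail is unchanged. [folklore] -/
theorem tail_reflE (u : 𝔼 (n + 1)) : tail n (reflE n u) = tail n u := by
  conv_lhs => rw [← consCLE_tail n u, reflE_consCLE, tail_consCLE]

/-- The reflection is an involution. [folklore] -/
theorem reflE_reflE (u : 𝔼 (n + 1)) : reflE n (reflE n u) = u := by
  conv_lhs => rw [← consCLE_tail n u, reflE_consCLE, reflE_consCLE, neg_neg]
  exact consCLE_tail n u

/-- The reflection preserves the norm. [folklore] -/
theorem norm_reflE (u : 𝔼 (n + 1)) : ‖reflE n u‖ = ‖u‖ :=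
  ((ℝ ∙ e0 n)ᗮ).reflection.norm_map u

/-- The reflection preserves Milnor's quadratic form of index `1`, `-u₀² + ‖y‖²`. [cite: MilnorHCobordism1965, Def. 3.1] -/
theorem milnorQuadratic_one_reflE (u : 𝔼 (n + 1)) : milnorQuadratic 1 (reflE n u) = milnorQuadratic 1 u := by
  conv_lhs => rw [← consCLE_tail n u, reflE_consCLE, milnorQuadratic_one_consCLE]
  conv_rhs => rw [← consCLE_tail n u, milnorQuadratic_one_consCLE]
  ring

/-- The Jacobian determinant of the reflection is `-1`. [folklore] -/
theorem det_reflE : LinearMap.det ((reflE n : 𝔼 (n + 1) →L[ℝ] 𝔼 (n + 1)) : 𝔼 (n + 1) →ₗ[ℝ] 𝔼 (n + 1)) = -1 := by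
  have h := Submodule.det_reflection (K := (ℝ ∙ e0 n)ᗮ)
  rw [Submodule.orthogonal_orthogonal, finrank_span_singleton (e0_ne_zero n), pow_one] at h
  exact h

/-- The reflection exchanges the model feet: `R (footModel s) = footModel (-s)`. [folklore] -/
theorem reflE_footModel (s m ρ : ℝ) (w : 𝔼 n) : reflE n (footModel n s m ρ w) = footModel n (-s) m ρ w := by
  rw [footModel, reflE_consCLE, footModel]; congr 2; ring

variable (c₀ : 𝔼 (n + 1)) (R : ℝ)

/-- The open ball `B(c₀, R)` as an open submanifold of `ℝⁿ⁺¹`. [folklore] -/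
abbrev Ball : TopologicalSpace.Opens (𝔼 (n + 1)) := ⟨ball c₀ R, isOpen_ball⟩

variable {n c₀ R}

/-- The centre. [folklore] -/
def centre (hR : 0 < R) : Ball n c₀ R := ⟨c₀, mem_ball_self hR⟩

/-- The ball is connected. [folklore] -/
theorem connectedSpace_ball (hR : 0 < R) : ConnectedSpace (Ball n c₀ R) :=
  isConnected_iff_connectedSpace.1 ⟨⟨c₀, mem_ball_self hR⟩, (convex_ball c₀ R).isPreconnected⟩

variable (n c₀ R)

/-- **The reflection about the centre as a self-diffeomorphism of the ball.** [folklore] -/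
def refl : Ball n c₀ R ≃ₘ⟮𝓡 (n + 1), 𝓡 (n + 1)⟯ Ball n c₀ R where
  toFun x := ⟨c₀ + reflE n (x.1 - c₀), by
    have hx : (x : 𝔼 (n + 1)) ∈ ball c₀ R := x.2
    show c₀ + reflE n (x.1 - c₀) ∈ ball c₀ R
    rw [Metric.mem_ball, dist_eq_norm] at hx ⊢
    rwa [add_sub_cancel_left, norm_reflE]⟩
  invFun x := ⟨c₀ + reflE n (x.1 - c₀), by
    have hx : (x : 𝔼 (n + 1)) ∈ ball c₀ R := x.2
    show c₀ + reflE n (x.1 - c₀) ∈ ball c₀ R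
    rw [Metric.mem_ball, dist_eq_norm] at hx ⊢
    rwa [add_sub_cancel_left, norm_reflE]⟩
  left_inv x := by ext1; simp [reflE_reflE]
  right_inv x := by ext1; simp [reflE_reflE]
  contMDiff_toFun := by
    rw [← ContMDiff.subtypeVal_comp_iff]
    have h : ContMDiff 𝓘(ℝ, 𝔼 (n + 1)) 𝓘(ℝ, 𝔼 (n + 1)) ∞ fun u : 𝔼 (n + 1) => c₀ + reflE n (u - c₀) :=
      (contDiff_const.add ((reflE n).contDiff.comp (contDiff_id.sub contDiff_const))).contMDiff
    exact h.comp contMDiff_subtype_val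
  contMDiff_invFun := by
    rw [← ContMDiff.subtypeVal_comp_iff]
    have h : ContMDiff 𝓘(ℝ, 𝔼 (n + 1)) 𝓘(ℝ, 𝔼 (n + 1)) ∞ fun u : 𝔼 (n + 1) => c₀ + reflE n (u - c₀) :=
      (contDiff_const.add ((reflE n).contDiff.comp (contDiff_id.sub contDiff_const))).contMDiff
    exact h.comp contMDiff_subtype_val

/-- The reflection on points. [folklore] -/
@[simp] theorem refl_coe (x : Ball n c₀ R) : ((refl n c₀ R x : Ball n c₀ R) : 𝔼 (n + 1)) = c₀ + reflE n (x.1 - c₀) := rfl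

variable {n c₀ R}

/-- The centre is fixed. [folklore] -/
theorem refl_centre (hR : 0 < R) : refl n c₀ R (centre hR) = centre hR := by
  ext1; simp [centre]

/-- **The differential of the reflection at the centre is the linear reflection.** [folklore] -/
theorem mfderiv_refl_centre (hR : 0 < R) :
    mfderiv (𝓡 (n + 1)) (𝓡 (n + 1)) (refl n c₀ R) (centre hR) = (reflE n : 𝔼 (n + 1) →L[ℝ] 𝔼 (n + 1)) := by
  set x₀ := centre (n := n) (c₀ := c₀) hR with hx₀
  have hn : (∞ : ℕ∞ω) ≠ 0 := by simp
  have hrefl : MDifferentiableAt (𝓡 (n + 1)) (𝓡 (n + 1)) (refl n c₀ R) x₀ := (refl n c₀ R).mdifferentiable hn x₀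
  -- `val ∘ refl = A ∘ val` with `A u = c₀ + R (u - c₀)`
  set A : 𝔼 (n + 1) → 𝔼 (n + 1) := fun u => c₀ + reflE n (u - c₀) with hA
  have hAd : HasFDerivAt A (reflE n : 𝔼 (n + 1) →L[ℝ] 𝔼 (n + 1)) (x₀ : 𝔼 (n + 1)) := by
    have h1 : HasFDerivAt (fun u : 𝔼 (n + 1) => u - c₀) (ContinuousLinearMap.id ℝ (𝔼 (n + 1))) (x₀ : 𝔼 (n + 1)) :=
      (hasFDerivAt_id _).sub_const c₀
    have h2 := ((reflE n).hasFDerivAt.comp (x₀ : 𝔼 (n + 1)) h1).const_add c₀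
    rw [ContinuousLinearMap.comp_id] at h2
    exact h2
  have hcomp : (Subtype.val : Ball n c₀ R → 𝔼 (n + 1)) ∘ refl n c₀ R = A ∘ Subtype.val := rfl
  have h1 : mfderiv (𝓡 (n + 1)) 𝓘(ℝ, 𝔼 (n + 1)) ((Subtype.val : Ball n c₀ R → 𝔼 (n + 1)) ∘ refl n c₀ R) x₀ =
      (mfderiv (𝓡 (n + 1)) 𝓘(ℝ, 𝔼 (n + 1)) (Subtype.val : Ball n c₀ R → 𝔼 (n + 1)) (refl n c₀ R x₀)).comp
        (mfderiv (𝓡 (n + 1)) (𝓡 (n + 1)) (refl n c₀ R) x₀) :=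
    mfderiv_comp x₀ (mdifferentiableAt_subtype_val _) hrefl
  have h2 : mfderiv (𝓡 (n + 1)) 𝓘(ℝ, 𝔼 (n + 1)) (A ∘ (Subtype.val : Ball n c₀ R → 𝔼 (n + 1))) x₀ =
      (mfderiv 𝓘(ℝ, 𝔼 (n + 1)) 𝓘(ℝ, 𝔼 (n + 1)) A (x₀ : 𝔼 (n + 1))).comp
        (mfderiv (𝓡 (n + 1)) 𝓘(ℝ, 𝔼 (n + 1)) (Subtype.val : Ball n c₀ R → 𝔼 (n + 1)) x₀) :=
    mfderiv_comp x₀ hAd.differentiableAt.mdifferentiableAt (mdifferentiableAt_subtype_val _)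
  rw [hcomp] at h1
  rw [h1, mfderiv_subtype_val, mfderiv_subtype_val, mfderiv_eq_fderiv, hAd.fderiv] at h2
  ext v
  exact ContinuousLinearMap.ext_iff.1 h2 v

/-- **The reflection reverses every orientation of the ball**: a diffeomorphism of the
connected ball either preserves or reverses a given orientation, and it cannot preserve it,
its Jacobian at the fixed centre being `det = -1` (Hirsch 1976, Ch. 4 §4, p. 105).
[cite: HirschDT1976, Ch. 4 §4, p. 105] -/
theorem refl_isOrientationReversing (hR : 0 < R) (o : SmoothOrientation (𝓡 (n + 1)) (Ball n c₀ R)) :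
    (refl n c₀ R).IsOrientationReversing o o := by
  haveI := connectedSpace_ball (n := n) (c₀ := c₀) hR
  have hn : (∞ : ℕ∞ω) ≠ 0 := by simp
  rcases Diffeomorph.isOrientationPreserving_or_isOrientationReversing_holds (refl n c₀ R) hn o o with h | h
  · exfalso
    have hdet : LinearMap.det (M := 𝔼 (n + 1))
        (mfderiv (𝓡 (n + 1)) (𝓡 (n + 1)) (refl n c₀ R) (centre hR)).toLinearMap = -1 := by
      have h' := det_reflE n
      rw [← mfderiv_refl_centre hR] at h'
      exact h'
    have h1 := h (centre hR)
    rw [refl_centre hR, hdet] at h1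
    have : (0 : ℝ) < -1 := h1.1 rfl
    linarith
  · exact h

/-- Milnor's quadratic form is smooth (a polynomial). [folklore] -/
theorem contDiff_milnorQuadratic' {m' : ℕ} (k : ℕ) : ContDiff ℝ ∞ (milnorQuadratic (m := m') k) := by
  have hc : ∀ i : Fin m', ContDiff ℝ ∞ fun u : 𝔼 m' => (u i) ^ 2 := fun i =>
    (EuclideanSpace.proj (𝕜 := ℝ) i).contDiff.pow 2
  unfold milnorQuadratic
  exact (ContDiff.sum fun i _ => hc i).neg.add (ContDiff.sum fun i _ => hc i)

variable (b m : ℝ)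

/-- **The model function** `g = b + Q₁(· - c₀)` on the ball. [cite: MilnorHCobordism1965, Def. 3.1] -/
def Q (x : Ball n c₀ R) : ℝ := b + milnorQuadratic 1 (x.1 - c₀)

variable {b m}

/-- `g` is smooth. [folklore] -/
theorem contMDiff_Q : ContMDiff (𝓡 (n + 1)) 𝓘(ℝ, ℝ) ∞ (Q (n := n) (c₀ := c₀) (R := R) b) := by
  have h : ContMDiff 𝓘(ℝ, 𝔼 (n + 1)) 𝓘(ℝ, ℝ) ∞ fun u : 𝔼 (n + 1) => b + milnorQuadratic 1 (u - c₀) :=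
    (contDiff_const.add ((contDiff_milnorQuadratic' 1).comp (contDiff_id.sub contDiff_const))).contMDiff
  exact h.comp contMDiff_subtype_val

/-- The reflection preserves `g`. [folklore] -/
theorem Q_refl (x : Ball n c₀ R) : Q b (refl n c₀ R x) = Q b x := by
  simp only [Q, refl_coe, add_sub_cancel_left, milnorQuadratic_one_reflE]

/-- **`b - m` is a regular level of `g`** for `m > 0`: on it `u = x - c₀ ≠ 0`, and the derivative
of `Q₁` at `u ≠ 0` does not vanish (`dQ₁(u) eᵢ = ±2uᵢ`). [cite: Milnor1963, §2] -/
theorem isRegularLevel_Q (hm : 0 < m) : IsRegularLevel (𝓡 (n + 1)) (Q (n := n) (c₀ := c₀) (R := R) b) (b - m) := by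
  refine isRegularLevel_of_not_isMCriticalPt contMDiff_Q fun x hx hc => ?_
  -- the derivative of `g` at `x` is `dQ₁(x - c₀)`
  set u : 𝔼 (n + 1) := x.1 - c₀ with hu
  have hQu : milnorQuadratic 1 u = -m := by
    have : b + milnorQuadratic 1 u = b - m := hx
    linarith
  have hu0 : u ≠ 0 := by
    intro h0; rw [h0, milnorQuadratic_zero] at hQu; linarith
  set G : 𝔼 (n + 1) → ℝ := fun v => b + milnorQuadratic 1 (v - c₀) with hG
  have hGd : HasFDerivAt G (∑ i : Fin (n + 1), ((if (i : ℕ) < 1 then -1 else 1) * (2 * u i)) •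
      (EuclideanSpace.proj (𝕜 := ℝ) i)) x.1 := by
    have h1 := (hasFDerivAt_milnorQuadratic 1 u).comp x.1 ((hasFDerivAt_id x.1).sub_const c₀)
    simp only [ContinuousLinearMap.comp_id] at h1
    exact h1.const_add b
  have hcomp : (Q b : Ball n c₀ R → ℝ) = G ∘ Subtype.val := rfl
  set L : 𝔼 (n + 1) →L[ℝ] ℝ := ∑ i : Fin (n + 1), ((if (i : ℕ) < 1 then -1 else 1) * (2 * u i)) •
      (EuclideanSpace.proj (𝕜 := ℝ) i) with hL
  have hmf : HasMFDerivAt (𝓡 (n + 1)) 𝓘(ℝ, ℝ) (Q b : Ball n c₀ R → ℝ) x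
      (L.comp (ContinuousLinearMap.id ℝ (𝔼 (n + 1)))) := by
    rw [hcomp]
    exact HasMFDerivAt.comp x (hGd.hasMFDerivAt) (hasMFDerivAt_subtype_val x)
  have hzero : L.comp (ContinuousLinearMap.id ℝ (𝔼 (n + 1))) = 0 := by
    have h1 := hmf.mfderiv
    rw [show mfderiv (𝓡 (n + 1)) 𝓘(ℝ, ℝ) (Q b : Ball n c₀ R → ℝ) x = 0 from hc] at h1
    exact h1.symm
  -- evaluate at `eᵢ` with `u i ≠ 0`
  obtain ⟨i, hi⟩ : ∃ i, u i ≠ 0 := by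
    by_contra hall; push Not at hall; exact hu0 (by ext i; simpa using hall i)
  have h0 : L (EuclideanSpace.single i 1) = 0 := by
    have := ContinuousLinearMap.ext_iff.1 hzero (EuclideanSpace.single i 1)
    exact this
  rw [hL] at h0
  simp only [FunLike.coe_sum, Finset.sum_apply, FunLike.coe_smul, Pi.smul_apply,
    EuclideanSpace.coe_proj, smul_eq_mul] at h0
  rw [Finset.sum_eq_single i (fun j _ hj => by simp [hj]) (by simp)] at h0
  simp only [PiLp.single_apply, if_true, mul_one] at h0
  rcases mul_eq_zero.1 h0 with h | h
  · split_ifs at h <;> linarith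
  · exact hi (by linarith)

variable {ρ : ℝ}

/-- **The model feet as maps into the ball**: `w ↦ c₀ + footModel s m ρ w` (`s = ±1`).
[cite: MilnorHCobordism1965, proof of Thm. 3.13] -/
def footB (hR : 0 < R) (hm : 0 < m) (hρ : 0 < ρ) (hmR : m + 2 * ρ ^ 2 ≤ R ^ 2) {s : ℝ} (hs : s ^ 2 = 1)
    (w : 𝔼 n) : Ball n c₀ R :=
  ⟨c₀ + footModel n s m ρ w, by
    show c₀ + footModel n s m ρ w ∈ ball c₀ R
    rw [Metric.mem_ball, dist_eq_norm, add_sub_cancel_left]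
    exact norm_footModel_lt hs hm.le hρ hR hmR w⟩

variable (hR : 0 < R) (hm : 0 < m) (hρ : 0 < ρ) (hmR : m + 2 * ρ ^ 2 ≤ R ^ 2)
include hR hm hρ hmR

/-- The model feet on points (definitional). [folklore] -/
@[simp] theorem footB_coe {s : ℝ} (hs : s ^ 2 = 1) (w : 𝔼 n) :
    ((footB hR hm hρ hmR hs w : Ball n c₀ R) : 𝔼 (n + 1)) = c₀ + footModel n s m ρ w := rfl

/-- The model feet are smooth. [folklore] -/
theorem contMDiff_footB {s : ℝ} (hs : s ^ 2 = 1) :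
    ContMDiff 𝓘(ℝ, 𝔼 n) (𝓡 (n + 1)) ∞ (footB (n := n) (c₀ := c₀) hR hm hρ hmR hs) := by
  rw [← ContMDiff.subtypeVal_comp_iff]
  exact (contDiff_const.add (contDiff_footModel hm)).contMDiff

/-- **The model feet lie on the level `b - m`.** [cite: MilnorHCobordism1965, Def. 3.1] -/
theorem Q_footB {s : ℝ} (hs : s ^ 2 = 1) (w : 𝔼 n) : Q b (footB (c₀ := c₀) hR hm hρ hmR hs w) = b - m := by
  show b + milnorQuadratic 1 (c₀ + footModel n s m ρ w - c₀) = b - m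
  rw [add_sub_cancel_left, milnorQuadratic_footModel hs hm.le]; ring

omit hR hm hρ hmR in
/-- A sign with `s² = 1` has `(-s)² = 1`. [folklore] -/
theorem neg_sq_eq_one {s : ℝ} (hs : s ^ 2 = 1) : (-s) ^ 2 = 1 := by rw [neg_sq]; exact hs

/-- **The reflection exchanges the two model feet.** [folklore] -/
theorem refl_footB {s : ℝ} (hs : s ^ 2 = 1) (w : 𝔼 n) :
    refl n c₀ R (footB hR hm hρ hmR hs w) = footB (c₀ := c₀) hR hm hρ hmR (neg_sq_eq_one hs) w := by
  ext1
  show c₀ + reflE n (c₀ + footModel n s m ρ w - c₀) = c₀ + footModel n (-s) m ρ w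
  rw [add_sub_cancel_left, reflE_footModel]

/-- **The reflection exchanges the two model feet** (the other direction). [folklore] -/
theorem refl_footB' {s : ℝ} (hs : s ^ 2 = 1) (w : 𝔼 n) :
    refl n c₀ R (footB hR hm hρ hmR (neg_sq_eq_one hs) w) = footB (c₀ := c₀) hR hm hρ hmR hs w := by
  ext1
  show c₀ + reflE n (c₀ + footModel n (-s) m ρ w - c₀) = c₀ + footModel n s m ρ w
  rw [add_sub_cancel_left, reflE_footModel, neg_neg]

end OneHandleModel

/-! ### Restricting a diffeomorphism to the boundaries (heterogeneous universes) -/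

section BoundaryRestrict

universe v

variable {n : ℕ} {W : Type u} {W' : Type v} [TopologicalSpace W] [ChartedSpace (EuclideanHalfSpace (n + 1)) W]
  [IsManifold (𝓡∂ (n + 1)) ∞ W] [TopologicalSpace W'] [ChartedSpace (EuclideanHalfSpace (n + 1)) W']
  [IsManifold (𝓡∂ (n + 1)) ∞ W']

omit [IsManifold (𝓡∂ (n + 1)) ∞ W] [IsManifold (𝓡∂ (n + 1)) ∞ W'] in
/-- A diffeomorphism maps boundary points to boundary points (Mathlib's
`Diffeomorph.image_boundary`). [folklore] -/
theorem _root_.Diffeomorph.apply_mem_boundary (Φ : W ≃ₘ⟮𝓡∂ (n + 1), 𝓡∂ (n + 1)⟯ W')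
    (z : ↥((𝓡∂ (n + 1)).boundary W)) : Φ z.1 ∈ (𝓡∂ (n + 1)).boundary W' := by
  rw [← Φ.image_boundary (by simp)]
  exact mem_image_of_mem Φ z.2

/-- **Restriction of a diffeomorphism of manifolds with boundary to the boundaries**, `∂Φ : ∂W ≅ ∂W'`
(the two manifolds may live in different universes; same construction as the tree's
`BoundaryData.restrictDiffeomorph`, smoothness by Mathlib's `ContMDiff.iff_comp_isImmersion`).
[cite: LeeSmoothManifolds2013, Thm. 5.11 and Cor. 5.30] -/
def _root_.Diffeomorph.toBoundaryDiffeomorph (Φ : W ≃ₘ⟮𝓡∂ (n + 1), 𝓡∂ (n + 1)⟯ W') :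
    ↥((𝓡∂ (n + 1)).boundary W) ≃ₘ⟮𝓡 n, 𝓡 n⟯ ↥((𝓡∂ (n + 1)).boundary W') where
  toFun z := ⟨Φ z.1, Φ.apply_mem_boundary z⟩
  invFun w := ⟨Φ.symm w.1, Φ.symm.apply_mem_boundary w⟩
  left_inv z := Subtype.ext (Φ.symm_apply_apply z.1)
  right_inv w := Subtype.ext (Φ.apply_symm_apply w.1)
  contMDiff_toFun := by
    rw [ContMDiff.iff_comp_isImmersion (BoundaryManifold.isImmersion_subtype_val (W := W'))]
    exact ⟨(Φ.continuous.comp continuous_subtype_val).subtype_mk _,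
      Φ.contMDiff.comp (BoundaryManifold.isImmersion_subtype_val (W := W)).contMDiff⟩
  contMDiff_invFun := by
    rw [ContMDiff.iff_comp_isImmersion (BoundaryManifold.isImmersion_subtype_val (W := W))]
    exact ⟨(Φ.symm.continuous.comp continuous_subtype_val).subtype_mk _,
      Φ.symm.contMDiff.comp (BoundaryManifold.isImmersion_subtype_val (W := W')).contMDiff⟩

/-- The restriction on points (definitional). [folklore] -/
@[simp] theorem _root_.Diffeomorph.toBoundaryDiffeomorph_coe (Φ : W ≃ₘ⟮𝓡∂ (n + 1), 𝓡∂ (n + 1)⟯ W')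
    (z : ↥((𝓡∂ (n + 1)).boundary W)) : ((Φ.toBoundaryDiffeomorph z : ↥((𝓡∂ (n + 1)).boundary W')) : W') = Φ z.1 :=
  rfl

end BoundaryRestrict

/-! ### §2 Transfer into a handle chart of index `1` -/

namespace HandleChart

/-- Local notation: `ℍ n` is the model half-space `EuclideanHalfSpace n`. -/
local notation "ℍ " n:arg => EuclideanHalfSpace n

variable {n : ℕ} {M : Type u} [TopologicalSpace M] [ChartedSpace (ℍ (n + 1)) M] [IsManifold (𝓡∂ (n + 1)) ∞ M]
  {f : M → ℝ} {X : Π x : M, TangentSpace (𝓡∂ (n + 1)) x} {p : M} (D : HandleChart (𝓡∂ (n + 1)) f X p)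
  {R : ℝ} (hball : closedBall (D.chart.extend (𝓡∂ (n + 1)) p) R ⊆ (D.chart.extend (𝓡∂ (n + 1))).target)

/-- The chart ball `B(φ̂ p, R)` of the handle chart, as an open submanifold of `ℝⁿ⁺¹`. [folklore] -/
abbrev Ball (D : HandleChart (𝓡∂ (n + 1)) f X p) (R : ℝ) : TopologicalSpace.Opens (𝔼 (n + 1)) :=
  OneHandleModel.Ball n (D.chart.extend (𝓡∂ (n + 1)) p) R

/-- **The inverse chart on the chart ball**, `ψ = φ̂⁻¹|_{B(φ̂ p, R)} : B → M`. [folklore] -/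
def ballInv (x : D.Ball R) : M := (D.chart.extend (𝓡∂ (n + 1))).symm x.1

include hball in
/-- `ψ` is smooth. [folklore] -/
theorem contMDiff_ballInv : ContMDiff (𝓡 (n + 1)) (𝓡∂ (n + 1)) ∞ (D.ballInv (R := R)) := fun x =>
  (D.contMDiffAt_extend_symm hball (x.2 : x.1 ∈ ball _ R)).comp x (contMDiff_subtype_val x)

omit [IsManifold (𝓡∂ (n + 1)) ∞ M] in
include hball in
/-- Points of the ball are chart values of points of the chart source. [folklore] -/
theorem ballInv_mem_source (x : D.Ball R) : D.ballInv x ∈ D.chart.source := by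
  have hx : x.1 ∈ (D.chart.extend (𝓡∂ (n + 1))).target := hball (ball_subset_closedBall x.2)
  have := (D.chart.extend (𝓡∂ (n + 1))).map_target hx
  rwa [D.chart.extend_source] at this

omit [IsManifold (𝓡∂ (n + 1)) ∞ M] in
include hball in
/-- `φ̂ (ψ x) = x`. [folklore] -/
theorem extend_ballInv (x : D.Ball R) : D.chart.extend (𝓡∂ (n + 1)) (D.ballInv x) = x.1 :=
  (D.chart.extend (𝓡∂ (n + 1))).right_inv (hball (ball_subset_closedBall x.2))

omit [IsManifold (𝓡∂ (n + 1)) ∞ M] in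
include hball in
/-- The chart coordinates of `ψ x` are `x - φ̂ p`. [folklore] -/
theorem coord_ballInv (x : D.Ball R) : D.coord (D.ballInv x) = x.1 - D.chart.extend (𝓡∂ (n + 1)) p := by
  rw [HandleChart.coord, D.extend_ballInv hball x]

omit [IsManifold (𝓡∂ (n + 1)) ∞ M] in
include hball in
/-- **`f ∘ ψ` is the model function** `f p + Q_k(· - φ̂ p)`. [cite: MilnorHCobordism1965, Def. 3.1] -/
theorem apply_ballInv (x : D.Ball R) :
    f (D.ballInv x) = f p + milnorQuadratic D.k (x.1 - D.chart.extend (𝓡∂ (n + 1)) p) := by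
  rw [D.apply_eq _ (D.ballInv_mem_source hball x), D.extend_ballInv hball x]

include hball in
/-- **The differential of `ψ` is invertible**: `dφ̂ ∘ dψ = id`. [folklore] -/
theorem det_mfderiv_ballInv_ne_zero (x : D.Ball R) :
    LinearMap.det (M := 𝔼 (n + 1)) (mfderiv (𝓡 (n + 1)) (𝓡∂ (n + 1)) (D.ballInv (R := R)) x).toLinearMap ≠ 0 := by
  have hn : (∞ : ℕ∞ω) ≠ 0 := by simp
  have hψ : MDifferentiableAt (𝓡 (n + 1)) (𝓡∂ (n + 1)) (D.ballInv (R := R)) x :=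
    (D.contMDiff_ballInv hball x).mdifferentiableAt hn
  have hφ : MDifferentiableAt (𝓡∂ (n + 1)) 𝓘(ℝ, 𝔼 (n + 1)) (D.chart.extend (𝓡∂ (n + 1))) (D.ballInv x) :=
    ((OpenPartialHomeomorph.contMDiffOn_extend (I := 𝓡∂ (n + 1)) D.mem_maximalAtlas).mdifferentiableOn hn _
      (D.ballInv_mem_source hball x)).mdifferentiableAt (D.chart.open_source.mem_nhds (D.ballInv_mem_source hball x))
  -- `φ̂ ∘ ψ = val` near `x`
  have hev : (D.chart.extend (𝓡∂ (n + 1)) ∘ D.ballInv (R := R)) =ᶠ[𝓝 x] (Subtype.val : D.Ball R → 𝔼 (n + 1)) :=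
    Filter.Eventually.of_forall fun y => D.extend_ballInv hball y
  have hid : mfderiv (𝓡 (n + 1)) 𝓘(ℝ, 𝔼 (n + 1)) (D.chart.extend (𝓡∂ (n + 1)) ∘ D.ballInv (R := R)) x =
      ContinuousLinearMap.id ℝ (𝔼 (n + 1)) := by
    rw [hev.mfderiv_eq]; exact mfderiv_subtype_val x
  have hcomp := mfderiv_comp x hφ hψ
  rw [hid] at hcomp
  -- hence `dψ_x` is injective
  have hinj : Injective (mfderiv (𝓡 (n + 1)) (𝓡∂ (n + 1)) (D.ballInv (R := R)) x) := by
    intro v w hvw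
    have hv : (mfderiv (𝓡∂ (n + 1)) 𝓘(ℝ, 𝔼 (n + 1)) (D.chart.extend (𝓡∂ (n + 1))) (D.ballInv x))
        ((mfderiv (𝓡 (n + 1)) (𝓡∂ (n + 1)) (D.ballInv (R := R)) x) v) = v :=
      (ContinuousLinearMap.ext_iff.1 hcomp v).symm
    have hw : (mfderiv (𝓡∂ (n + 1)) 𝓘(ℝ, 𝔼 (n + 1)) (D.chart.extend (𝓡∂ (n + 1))) (D.ballInv x))
        ((mfderiv (𝓡 (n + 1)) (𝓡∂ (n + 1)) (D.ballInv (R := R)) x) w) = w :=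
      (ContinuousLinearMap.ext_iff.1 hcomp w).symm
    rw [← hv, ← hw, hvw]
  set A : 𝔼 (n + 1) →ₗ[ℝ] 𝔼 (n + 1) := (mfderiv (𝓡 (n + 1)) (𝓡∂ (n + 1)) (D.ballInv (R := R)) x).toLinearMap with hA
  have hunit : IsUnit A := (LinearMap.isUnit_iff_ker_eq_bot A).2 (LinearMap.ker_eq_bot.2 hinj)
  exact ((LinearMap.isUnit_iff_isUnit_det A).1 hunit).ne_zero

/-! #### The sublevel pieces -/

variable {m : ℝ} [csW : ChartedSpace (ℍ (n + 1)) ↥(f ⁻¹' Iic (f p - m))]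
  [mfdW : IsManifold (𝓡∂ (n + 1)) ∞ ↥(f ⁻¹' Iic (f p - m))]

/-- The part of the sublevel set `{f ≤ f p - m}` lying in the chart ball of radius `R`, as an
open submanifold. [folklore] -/
def sublevelBall (D : HandleChart (𝓡∂ (n + 1)) f X p) (m R : ℝ) : TopologicalSpace.Opens ↥(f ⁻¹' Iic (f p - m)) :=
  ⟨{x | (x : M) ∈ D.cball R}, D.isOpen_cball.preimage continuous_subtype_val⟩

omit [IsManifold (𝓡∂ (n + 1)) ∞ M] csW mfdW in
/-- The model function on the ball has the regular level `f p - m`. [folklore] -/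
theorem isRegularLevel_ballModel (hm : 0 < m) :
    IsRegularLevel (𝓡 (n + 1)) (OneHandleModel.Q (n := n) (c₀ := D.chart.extend (𝓡∂ (n + 1)) p) (R := R) (f p)) (f p - m) :=
  OneHandleModel.isRegularLevel_Q hm

omit [IsManifold (𝓡∂ (n + 1)) ∞ M] in
include hball in
/-- `f ∘ ψ` is the model function of index `1`. [folklore] -/
theorem apply_ballInv_eq_Q (hk : D.k = 1) (x : D.Ball R) : f (D.ballInv x) = OneHandleModel.Q (f p) x := by
  rw [D.apply_ballInv hball x, hk]; rfl

/-- **The data of the transfer**: the chart ball inside the target, `f` smooth, the level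
`f p - m` regular with interior sublevel set, and the structure of `{f ≤ f p - m}` being the one
of `sublevelAtlas`. [folklore] -/
structure TransferData (D : HandleChart (𝓡∂ (n + 1)) f X p) (R m : ℝ)
    [csW : ChartedSpace (ℍ (n + 1)) ↥(f ⁻¹' Iic (f p - m))] : Prop where
  hball : closedBall (D.chart.extend (𝓡∂ (n + 1)) p) R ⊆ (D.chart.extend (𝓡∂ (n + 1))).target
  hf : ContMDiff (𝓡∂ (n + 1)) 𝓘(ℝ, ℝ) ∞ f
  hint : ∀ q, f q ≤ f p - m → (𝓡∂ (n + 1)).IsInteriorPoint q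
  hreg : ∀ q, f q = f p - m → ¬ IsMCriticalPt (𝓡∂ (n + 1)) f q
  hcs : csW = (sublevelAtlas hf (f p - m) hint hreg).chartedSpace
  hk : D.k = 1
  hm : 0 < m
  hn : 1 ≤ n
  hR : 0 < R

variable {D} (T : D.TransferData R m)

namespace TransferData

include T

omit mfdW in
/-- The regular level of the model function. [folklore] -/
theorem isRegularLevel : IsRegularLevel (𝓡 (n + 1))
    (OneHandleModel.Q (n := n) (c₀ := D.chart.extend (𝓡∂ (n + 1)) p) (R := R) (f p)) (f p - m) :=
  D.isRegularLevel_ballModel T.hm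

/-- The inclusion `{f ≤ f p - m} → M` is smooth. [folklore] -/
theorem contMDiff_val : ContMDiff (𝓡∂ (n + 1)) (𝓡∂ (n + 1)) ∞ (Subtype.val : ↥(f ⁻¹' Iic (f p - m)) → M) := by
  obtain ⟨_, hf, hint, hreg, hcs, _, _, _, _⟩ := T
  subst hcs
  letI := (sublevelAtlas hf (f p - m) hint hreg).chartedSpace
  exact (sublevelAtlas hf (f p - m) hint hreg).contMDiff_subtype_val_of_halfSlice

/-- The Jacobian of the inclusion `{f ≤ f p - m} → M` does not vanish. [folklore] -/
theorem det_mfderiv_val_ne_zero (x : ↥(f ⁻¹' Iic (f p - m))) :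
    LinearMap.det (M := 𝔼 (n + 1)) (mfderiv (𝓡∂ (n + 1)) (𝓡∂ (n + 1))
      (Subtype.val : ↥(f ⁻¹' Iic (f p - m)) → M) x).toLinearMap ≠ 0 := by
  obtain ⟨_, hf, hint, hreg, hcs, _, _, hn, _⟩ := T
  subst hcs
  letI := (sublevelAtlas hf (f p - m) hint hreg).chartedSpace
  exact det_mfderiv_ne_zero_of_isImmersionAt
    (((sublevelAtlas hf (f p - m) hint hreg).isImmersion_subtype_val hn).isImmersionAt x)

/-- Smooth maps into `M` with values in `{f ≤ f p - m}` are smooth into it. [cite: LeeSmoothManifolds2013, Cor. 5.30] -/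
theorem contMDiff_codRestrict {E' H' : Type*} [NormedAddCommGroup E'] [NormedSpace ℝ E'] [TopologicalSpace H']
    {J : ModelWithCorners ℝ E' H'} {N : Type*} [TopologicalSpace N] [ChartedSpace H' N]
    {g : N → M} (hg : ContMDiff J (𝓡∂ (n + 1)) ∞ g) (hgle : ∀ x, f (g x) ≤ f p - m) :
    ContMDiff J (𝓡∂ (n + 1)) ∞ fun x => (⟨g x, hgle x⟩ : ↥(f ⁻¹' Iic (f p - m))) := by
  obtain ⟨_, hf, hint, hreg, hcs, _, _, _, _⟩ := T
  subst hcs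
  letI := (sublevelAtlas hf (f p - m) hint hreg).chartedSpace
  exact (sublevelAtlas hf (f p - m) hint hreg).contMDiff_codRestrict hgle hg

/-- **The inverse chart identifies the model sublevel piece with the sublevel piece in the chart
ball**, `{Q ≤ f p - m} ∩ B ≅ {f ≤ f p - m} ∩ φ̂⁻¹(B)` (global diffeomorphism of manifolds with
boundary). [cite: Milnor1963, Thm. 3.1] -/
def sublevelDiffeomorph : RegularSublevel T.isRegularLevel ≃ₘ⟮𝓡∂ (n + 1), 𝓡∂ (n + 1)⟯ (D.sublevelBall m R) :=
  have hle : ∀ x : RegularSublevel T.isRegularLevel, f (D.ballInv (RegularSublevel.incl T.isRegularLevel x)) ≤ f p - m :=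
    fun x => by rw [D.apply_ballInv_eq_Q T.hball T.hk]; exact RegularSublevel.apply_incl_le _ x
  have hmem : ∀ x : RegularSublevel T.isRegularLevel, D.ballInv (RegularSublevel.incl T.isRegularLevel x) ∈ D.cball R :=
    fun x => by
      refine ⟨D.ballInv_mem_source T.hball _, ?_⟩
      rw [D.coord_ballInv T.hball]
      have this' : ((RegularSublevel.incl T.isRegularLevel x : D.Ball R) : 𝔼 (n + 1)) ∈
          ball (D.chart.extend (𝓡∂ (n + 1)) p) R := (RegularSublevel.incl T.isRegularLevel x).2
      rwa [Metric.mem_ball, dist_eq_norm] at this'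
  have hballmem : ∀ y : D.sublevelBall m R,
      D.chart.extend (𝓡∂ (n + 1)) ((y : ↥(f ⁻¹' Iic (f p - m))) : M) ∈ ball (D.chart.extend (𝓡∂ (n + 1)) p) R :=
    fun y => by
      have hy : ((y : ↥(f ⁻¹' Iic (f p - m))) : M) ∈ D.cball R := y.2
      rw [Metric.mem_ball, dist_eq_norm]; exact hy.2
  have hle' : ∀ y : D.sublevelBall m R, OneHandleModel.Q (n := n) (c₀ := D.chart.extend (𝓡∂ (n + 1)) p) (R := R) (f p)
      ⟨D.chart.extend (𝓡∂ (n + 1)) ((y : ↥(f ⁻¹' Iic (f p - m))) : M), hballmem y⟩ ≤ f p - m := fun y => by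
    have hy : ((y : ↥(f ⁻¹' Iic (f p - m))) : M) ∈ D.cball R := y.2
    show f p + milnorQuadratic 1 (D.chart.extend (𝓡∂ (n + 1)) ((y : ↥(f ⁻¹' Iic (f p - m))) : M) -
      D.chart.extend (𝓡∂ (n + 1)) p) ≤ f p - m
    have h1 := D.apply_eq _ hy.1
    rw [T.hk] at h1
    have h2 : f ((y : ↥(f ⁻¹' Iic (f p - m))) : M) ≤ f p - m := (y : ↥(f ⁻¹' Iic (f p - m))).2
    change f _ = f p + milnorQuadratic 1 (D.coord _) at h1
    rw [HandleChart.coord] at h1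
    linarith
  { toFun := fun x => ⟨⟨D.ballInv (RegularSublevel.incl T.isRegularLevel x), hle x⟩, hmem x⟩
    invFun := fun y => RegularSublevel.mk T.isRegularLevel
      ⟨D.chart.extend (𝓡∂ (n + 1)) ((y : ↥(f ⁻¹' Iic (f p - m))) : M), hballmem y⟩ (hle' y)
    left_inv := fun x => by
      apply RegularSublevel.injective_incl
      apply Subtype.ext
      exact D.extend_ballInv T.hball _
    right_inv := fun y => by
      have hy : ((y : ↥(f ⁻¹' Iic (f p - m))) : M) ∈ D.cball R := y.2
      apply Subtype.ext; apply Subtype.ext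
      exact (D.chart.extend (𝓡∂ (n + 1))).left_inv (by rw [D.chart.extend_source]; exact hy.1)
    contMDiff_toFun := by
      rw [← ContMDiff.subtypeVal_comp_iff]
      exact T.contMDiff_codRestrict ((D.contMDiff_ballInv T.hball).comp (RegularSublevel.contMDiff_incl _)) hle
    contMDiff_invFun := by
      have hval : ContMDiff (𝓡∂ (n + 1)) (𝓡∂ (n + 1)) ∞ fun y : D.sublevelBall m R => ((y : ↥(f ⁻¹' Iic (f p - m))) : M) :=
        T.contMDiff_val.comp contMDiff_subtype_val
      have hg' : ContMDiff (𝓡∂ (n + 1)) 𝓘(ℝ, 𝔼 (n + 1)) ∞ fun y : D.sublevelBall m R =>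
          D.chart.extend (𝓡∂ (n + 1)) ((y : ↥(f ⁻¹' Iic (f p - m))) : M) := by
        intro y
        have hy : ((y : ↥(f ⁻¹' Iic (f p - m))) : M) ∈ D.cball R := y.2
        exact ((OpenPartialHomeomorph.contMDiffOn_extend (I := 𝓡∂ (n + 1)) D.mem_maximalAtlas).contMDiffAt
          (D.chart.open_source.mem_nhds hy.1)).comp y (hval y)
      have hg : ContMDiff (𝓡∂ (n + 1)) (𝓡 (n + 1)) ∞ fun y : D.sublevelBall m R =>
          (⟨D.chart.extend (𝓡∂ (n + 1)) ((y : ↥(f ⁻¹' Iic (f p - m))) : M), hballmem y⟩ : D.Ball R) := by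
        rw [← ContMDiff.subtypeVal_comp_iff]; exact hg'
      have := (RegularSublevel.halfSliceAtlas T.isRegularLevel).contMDiff_codRestrict hle' hg
      exact this }

/-- The identification on points of `M` (definitional). [folklore] -/
@[simp] theorem sublevelDiffeomorph_coe (x : RegularSublevel T.isRegularLevel) :
    (((T.sublevelDiffeomorph x : D.sublevelBall m R) : ↥(f ⁻¹' Iic (f p - m))) : M) =
      D.ballInv (RegularSublevel.incl T.isRegularLevel x) := rfl

/-! #### Orientations -/

variable (oM : SmoothOrientation (𝓡∂ (n + 1)) M)

/-- The orientation of the chart ball pulled back from `oM` along `ψ`. [cite: HirschDT1976, §4.4 p. 101] -/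
def ballOrientation : SmoothOrientation (𝓡 (n + 1)) (D.Ball R) :=
  oM.comapOfDetNeZero (D.ballInv (R := R)) (D.contMDiff_ballInv T.hball) (by simp) (D.det_mfderiv_ballInv_ne_zero T.hball)

omit mfdW in
/-- `ψ` preserves `(ballOrientation, oM)` by construction. [cite: HirschDT1976, §4.4 p. 101] -/
theorem isOrientationPreserving_ballInv : IsOrientationPreserving (T.ballOrientation oM) oM (D.ballInv (R := R)) :=
  SmoothOrientation.isOrientationPreserving_comapOfDetNeZero oM _ _ _ _

/-- The orientation of the sublevel set `{f ≤ f p - m}` pulled back from `oM` along the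
inclusion. [cite: HirschDT1976, §4.4 p. 101] -/
def sublevelOrientation : SmoothOrientation (𝓡∂ (n + 1)) ↥(f ⁻¹' Iic (f p - m)) :=
  oM.comapOfDetNeZero (Subtype.val : ↥(f ⁻¹' Iic (f p - m)) → M) T.contMDiff_val (by simp) T.det_mfderiv_val_ne_zero

/-- The inclusion `{f ≤ f p - m} → M` preserves `(sublevelOrientation, oM)`. [cite: HirschDT1976, §4.4 p. 101] -/
theorem isOrientationPreserving_val :
    IsOrientationPreserving (T.sublevelOrientation oM) oM (Subtype.val : ↥(f ⁻¹' Iic (f p - m)) → M) :=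
  SmoothOrientation.isOrientationPreserving_comapOfDetNeZero oM _ _ _ _

/-- The model orientation of `{Q ≤ f p - m} ∩ B`. [folklore] -/
abbrev modelOrientation : SmoothOrientation (𝓡∂ (n + 1)) (RegularSublevel T.isRegularLevel) :=
  RegularSublevel.orientation T.isRegularLevel (T.ballOrientation oM)

/-- **The identification of the sublevel pieces preserves the orientations induced from `oM`**:
`val ∘ val ∘ Φ = ψ ∘ incl` with all other maps orientation-preserving local diffeomorphisms
(cancel on the left). [cite: HirschDT1976, §4.4 p. 101] -/
theorem sublevelDiffeomorph_isOrientationPreserving :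
    T.sublevelDiffeomorph.IsOrientationPreserving (T.modelOrientation oM)
      ((T.sublevelOrientation oM).restrict (D.sublevelBall m R)) := by
  have hn' : (∞ : ℕ∞ω) ≠ 0 := by simp
  set h := T.isRegularLevel with hh
  set Φ := T.sublevelDiffeomorph with hΦ
  set oN := T.sublevelOrientation oM with hoN
  -- `g = val_N ∘ val_U : U_N → M` preserves `(oN|_U, oM)`
  set g : D.sublevelBall m R → M := fun y => ((y : ↥(f ⁻¹' Iic (f p - m))) : M) with hg
  have hvalU : IsOrientationPreserving (oN.restrict (D.sublevelBall m R)) oN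
      (Subtype.val : D.sublevelBall m R → ↥(f ⁻¹' Iic (f p - m))) := fun y => by
    rw [det_mfderiv_subtype_val, SmoothOrientation.restrict_apply]
    exact iff_of_true rfl one_pos
  have hvalN := T.isOrientationPreserving_val oM
  have hmdN : MDifferentiable (𝓡∂ (n + 1)) (𝓡∂ (n + 1)) (Subtype.val : ↥(f ⁻¹' Iic (f p - m)) → M) :=
    T.contMDiff_val.mdifferentiable hn'
  have hmdU : MDifferentiable (𝓡∂ (n + 1)) (𝓡∂ (n + 1))
      (Subtype.val : D.sublevelBall m R → ↥(f ⁻¹' Iic (f p - m))) := fun y => mdifferentiableAt_subtype_val y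
  have hdetU : ∀ y : D.sublevelBall m R, LinearMap.det (M := 𝔼 (n + 1)) (mfderiv (𝓡∂ (n + 1)) (𝓡∂ (n + 1))
      (Subtype.val : D.sublevelBall m R → ↥(f ⁻¹' Iic (f p - m))) y).toLinearMap ≠ 0 := fun y => by
    rw [det_mfderiv_subtype_val]; exact one_ne_zero
  have hg_or : IsOrientationPreserving (oN.restrict (D.sublevelBall m R)) oM g :=
    IsOrientationPreserving.comp_holds hvalN hvalU hmdN hmdU T.det_mfderiv_val_ne_zero hdetU
  have hg_md : MDifferentiable (𝓡∂ (n + 1)) (𝓡∂ (n + 1)) g := hmdN.comp hmdU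
  have hg_det : ∀ y, LinearMap.det (M := 𝔼 (n + 1)) (mfderiv (𝓡∂ (n + 1)) (𝓡∂ (n + 1)) g y).toLinearMap ≠ 0 := by
    intro y
    have hcg : g = (Subtype.val : ↥(f ⁻¹' Iic (f p - m)) → M) ∘ (Subtype.val : D.sublevelBall m R → _) := rfl
    rw [hcg, mfderiv_comp y (hmdN _) (hmdU y)]
    have h1 : LinearMap.det (M := 𝔼 (n + 1))
        ((mfderiv (𝓡∂ (n + 1)) (𝓡∂ (n + 1)) (Subtype.val : ↥(f ⁻¹' Iic (f p - m)) → M)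
          (y : ↥(f ⁻¹' Iic (f p - m)))).comp
        (mfderiv (𝓡∂ (n + 1)) (𝓡∂ (n + 1))
          (Subtype.val : D.sublevelBall m R → ↥(f ⁻¹' Iic (f p - m))) y)).toLinearMap =
        LinearMap.det (M := 𝔼 (n + 1)) (mfderiv (𝓡∂ (n + 1)) (𝓡∂ (n + 1))
          (Subtype.val : ↥(f ⁻¹' Iic (f p - m)) → M) (y : ↥(f ⁻¹' Iic (f p - m)))).toLinearMap *
        LinearMap.det (M := 𝔼 (n + 1)) (mfderiv (𝓡∂ (n + 1)) (𝓡∂ (n + 1))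
          (Subtype.val : D.sublevelBall m R → ↥(f ⁻¹' Iic (f p - m))) y).toLinearMap :=
      LinearMap.det_comp (M := 𝔼 (n + 1)) _ _
    exact h1 ▸ mul_ne_zero (T.det_mfderiv_val_ne_zero _) (hdetU y)
  -- `g ∘ Φ = ψ ∘ incl` preserves `(orientation h oB, oM)`
  have hcomp : g ∘ Φ = D.ballInv (R := R) ∘ RegularSublevel.incl h := rfl
  have hψincl : IsOrientationPreserving (T.modelOrientation oM) oM (D.ballInv (R := R) ∘ RegularSublevel.incl h) :=
    IsOrientationPreserving.comp_holds (T.isOrientationPreserving_ballInv oM)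
      (RegularSublevel.isOrientationPreserving_incl h _) ((D.contMDiff_ballInv T.hball).mdifferentiable hn')
      ((RegularSublevel.contMDiff_incl h).mdifferentiable hn') (D.det_mfderiv_ballInv_ne_zero T.hball)
      (RegularSublevel.det_mfderiv_incl_ne_zero h)
  rw [← hcomp] at hψincl
  exact IsOrientationPreserving.of_comp_left hψincl hg_or hg_md (Φ.mdifferentiable hn') hg_det
    (Φ.det_mfderiv_ne_zero hn')

/-! #### The level pieces -/

/-- **The boundary restriction** `∂({Q ≤ f p - m} ∩ B) ≅ ∂({f ≤ f p - m} ∩ φ̂⁻¹ B)` of the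
identification (`BoundaryData.restrictDiffeomorph`). [cite: LeeSmoothManifolds2013, Thm. 5.11] -/
def levelDiffeomorph :
    ↥((𝓡∂ (n + 1)).boundary (RegularSublevel T.isRegularLevel)) ≃ₘ⟮𝓡 n, 𝓡 n⟯
      ↥((𝓡∂ (n + 1)).boundary (D.sublevelBall m R)) :=
  T.sublevelDiffeomorph.toBoundaryDiffeomorph

/-- The boundary restriction on points. [folklore] -/
theorem levelDiffeomorph_coe (z : ↥((𝓡∂ (n + 1)).boundary (RegularSublevel T.isRegularLevel))) :
    ((T.levelDiffeomorph z).1 : D.sublevelBall m R) = T.sublevelDiffeomorph z.1 :=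
  rfl

/-- **The boundary restriction preserves the boundary orientations.** [cite: HirschDT1976, §4.4 p. 103] -/
theorem levelDiffeomorph_isOrientationPreserving :
    T.levelDiffeomorph.IsOrientationPreserving (T.modelOrientation oM).boundary
      ((T.sublevelOrientation oM).restrict (D.sublevelBall m R)).boundary :=
  Diffeomorph.isOrientationPreserving_boundaryMap T.sublevelDiffeomorph (ρ := T.levelDiffeomorph)
    T.levelDiffeomorph_coe (T.sublevelDiffeomorph_isOrientationPreserving oM)

/-! #### The feet, lifted to the level, and their orientation characters -/

omit mfdW in
/-- The feet lie on the level `f p - m`. [cite: MilnorHCobordism1965, Def. 3.1] -/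
theorem apply_foot {ρ : ℝ} (hρ : 0 < ρ) (hmR : m + 2 * ρ ^ 2 ≤ R ^ 2) {s : ℝ} (hs : s ^ 2 = 1) (w : 𝔼 n) :
    f (D.foot s m ρ w) = f p - m :=
  D.apply_foot hs T.hm hρ T.hR hmR T.hball T.hk w

/-- **The feet of the `1`-handle lifted to the level manifold `∂{f ≤ f p - m}`** (`s = ±1`).
[cite: MilnorHCobordism1965, proof of Thm. 3.13] -/
def footLift {ρ : ℝ} (hρ : 0 < ρ) (hmR : m + 2 * ρ ^ 2 ≤ R ^ 2) {s : ℝ} (hs : s ^ 2 = 1) :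
    𝔼 n → ↥((𝓡∂ (n + 1)).boundary ↥(f ⁻¹' Iic (f p - m))) :=
  levelLift T.hcs (D.foot s m ρ) (T.apply_foot hρ hmR hs)

omit mfdW in
/-- The underlying point of the lifted foot (definitional). [folklore] -/
@[simp] theorem footLift_coe {ρ : ℝ} (hρ : 0 < ρ) (hmR : m + 2 * ρ ^ 2 ≤ R ^ 2) {s : ℝ} (hs : s ^ 2 = 1) (w : 𝔼 n) :
    (((T.footLift hρ hmR hs w).1 : ↥(f ⁻¹' Iic (f p - m))) : M) = D.foot s m ρ w := rfl

/-- **The lifted feet are smooth embeddings** (`isSmoothEmbedding_levelLift` with the foot domain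
and `footInv`). [cite: LeeSmoothManifolds2013, Prop. 5.2] -/
theorem isSmoothEmbedding_footLift {ρ : ℝ} (hρ : 0 < ρ) (hmR : m + 2 * ρ ^ 2 ≤ R ^ 2) {s : ℝ} (hs : s ^ 2 = 1) :
    Manifold.IsSmoothEmbedding 𝓘(ℝ, 𝔼 n) (𝓡 n) ∞ (T.footLift hρ hmR hs) :=
  (isSmoothEmbedding_levelLift T.hcs T.hn (D.contMDiff_foot T.hm T.hR hmR T.hball hs hρ) (T.apply_foot hρ hmR hs)
    D.isOpen_footDomain (D.range_foot hs T.hm hρ T.hR hmR T.hball T.hk) (D.contMDiffOn_footInv hρ)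
    (D.footInv_foot hs T.hm hρ T.hR hmR T.hball)).1

/-- The lifted feet have invertible differentials. [folklore] -/
theorem det_mfderiv_footLift_ne_zero {ρ : ℝ} (hρ : 0 < ρ) (hmR : m + 2 * ρ ^ 2 ≤ R ^ 2) {s : ℝ} (hs : s ^ 2 = 1)
    (w : 𝔼 n) : LinearMap.det (M := 𝔼 n) (mfderiv 𝓘(ℝ, 𝔼 n) (𝓡 n) (T.footLift hρ hmR hs) w).toLinearMap ≠ 0 :=
  det_mfderiv_ne_zero_of_isImmersionAt ((T.isSmoothEmbedding_footLift hρ hmR hs).isImmersion.isImmersionAt w)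

/-- **The transfer map** `∂({Q ≤ f p - m} ∩ B) ≅ ∂({f ≤ f p - m} ∩ φ̂⁻¹ B) ⊆ ∂{f ≤ f p - m}`. [folklore] -/
def transferMap (z : ↥((𝓡∂ (n + 1)).boundary (RegularSublevel T.isRegularLevel))) :
    ↥((𝓡∂ (n + 1)).boundary ↥(f ⁻¹' Iic (f p - m))) :=
  Opens.boundaryIncl (n := n) (D.sublevelBall m R) (T.levelDiffeomorph z)

/-- The transfer map is differentiable. [folklore] -/
theorem mdifferentiable_transferMap : MDifferentiable (𝓡 n) (𝓡 n) T.transferMap :=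
  (Opens.mdifferentiable_boundaryIncl (n := n) (D.sublevelBall m R)).comp (T.levelDiffeomorph.mdifferentiable (by simp))

/-- The transfer map has invertible differentials. [folklore] -/
theorem det_mfderiv_transferMap_ne_zero (z : ↥((𝓡∂ (n + 1)).boundary (RegularSublevel T.isRegularLevel))) :
    LinearMap.det (M := 𝔼 n) (mfderiv (𝓡 n) (𝓡 n) T.transferMap z).toLinearMap ≠ 0 := by
  have hn' : (∞ : ℕ∞ω) ≠ 0 := by simp
  have hcomp := mfderiv_comp z (Opens.mdifferentiable_boundaryIncl (n := n) (D.sublevelBall m R) _)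
    (T.levelDiffeomorph.mdifferentiable hn' z)
  change LinearMap.det (M := 𝔼 n) (mfderiv (𝓡 n) (𝓡 n)
    (Opens.boundaryIncl (n := n) (D.sublevelBall m R) ∘ T.levelDiffeomorph) z).toLinearMap ≠ 0
  rw [hcomp]
  have h1 := LinearMap.det_comp (M := 𝔼 n)
    (mfderiv (𝓡 n) (𝓡 n) (Opens.boundaryIncl (n := n) (D.sublevelBall m R)) (T.levelDiffeomorph z)).toLinearMap
    (mfderiv (𝓡 n) (𝓡 n) T.levelDiffeomorph z).toLinearMap
  intro h0
  refine mul_ne_zero (Opens.det_mfderiv_boundaryIncl_ne_zero (n := n) (D.sublevelBall m R) _)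
    (T.levelDiffeomorph.det_mfderiv_ne_zero hn' z) (h1.symm.trans h0)

/-- **The transfer map preserves the boundary orientations.** [cite: HirschDT1976, §4.4 p. 103] -/
theorem transferMap_isOrientationPreserving :
    IsOrientationPreserving (T.modelOrientation oM).boundary (T.sublevelOrientation oM).boundary T.transferMap :=
  IsOrientationPreserving.comp_holds (Opens.isOrientationPreserving_boundaryIncl (n := n) (D.sublevelBall m R) _)
    (T.levelDiffeomorph_isOrientationPreserving oM) (Opens.mdifferentiable_boundaryIncl (n := n) (D.sublevelBall m R))
    (T.levelDiffeomorph.mdifferentiable (by simp))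
    (Opens.det_mfderiv_boundaryIncl_ne_zero (n := n) (D.sublevelBall m R))
    (T.levelDiffeomorph.det_mfderiv_ne_zero (by simp))

omit mfdW in
/-- The model feet lie on the level of `Q`. [folklore] -/
theorem Q_footB {ρ : ℝ} (hρ : 0 < ρ) (hmR : m + 2 * ρ ^ 2 ≤ R ^ 2) {s : ℝ} (hs : s ^ 2 = 1) (w : 𝔼 n) :
    OneHandleModel.Q (f p) (OneHandleModel.footB (c₀ := D.chart.extend (𝓡∂ (n + 1)) p) T.hR T.hm hρ hmR hs w) =
      f p - m :=
  OneHandleModel.Q_footB T.hR T.hm hρ hmR hs w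

/-- **The model feet lifted to the model level** `∂({Q ≤ f p - m} ∩ B)`. [folklore] -/
abbrev modelFootLift {ρ : ℝ} (hρ : 0 < ρ) (hmR : m + 2 * ρ ^ 2 ≤ R ^ 2) {s : ℝ} (hs : s ^ 2 = 1) :
    𝔼 n → ↥((𝓡∂ (n + 1)).boundary (RegularSublevel T.isRegularLevel)) :=
  RegularSublevel.levelFoot T.isRegularLevel
    (OneHandleModel.footB (c₀ := D.chart.extend (𝓡∂ (n + 1)) p) T.hR T.hm hρ hmR hs) (T.Q_footB hρ hmR hs)

/-- **The lifted feet factor through the transfer map**: `footLift = transfer ∘ modelFootLift`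
(definitional). [folklore] -/
theorem footLift_eq_comp {ρ : ℝ} (hρ : 0 < ρ) (hmR : m + 2 * ρ ^ 2 ≤ R ^ 2) {s : ℝ} (hs : s ^ 2 = 1) :
    T.footLift hρ hmR hs = T.transferMap ∘ T.modelFootLift hρ hmR hs :=
  rfl

omit mfdW in
/-- The model lifted feet are smooth. [folklore] -/
theorem contMDiff_modelFootLift {ρ : ℝ} (hρ : 0 < ρ) (hmR : m + 2 * ρ ^ 2 ≤ R ^ 2) {s : ℝ} (hs : s ^ 2 = 1) :
    ContMDiff 𝓘(ℝ, 𝔼 n) (𝓡 n) ∞ (T.modelFootLift hρ hmR hs) :=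
  RegularSublevel.contMDiff_levelFoot T.isRegularLevel (OneHandleModel.contMDiff_footB T.hR T.hm hρ hmR hs) _

/-- The model lifted feet have invertible differentials (from those of `footLift`). [folklore] -/
theorem det_mfderiv_modelFootLift_ne_zero {ρ : ℝ} (hρ : 0 < ρ) (hmR : m + 2 * ρ ^ 2 ≤ R ^ 2) {s : ℝ}
    (hs : s ^ 2 = 1) (w : 𝔼 n) :
    LinearMap.det (M := 𝔼 n) (mfderiv 𝓘(ℝ, 𝔼 n) (𝓡 n) (T.modelFootLift hρ hmR hs) w).toLinearMap ≠ 0 := by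
  have hfd : MDifferentiableAt 𝓘(ℝ, 𝔼 n) (𝓡 n) (T.modelFootLift hρ hmR hs) w :=
    (T.contMDiff_modelFootLift hρ hmR hs w).mdifferentiableAt (by simp)
  have hcomp := mfderiv_comp w (T.mdifferentiable_transferMap _) hfd
  have hne := T.det_mfderiv_footLift_ne_zero hρ hmR hs w
  rw [T.footLift_eq_comp hρ hmR hs, hcomp] at hne
  have h1 := LinearMap.det_comp (M := 𝔼 n)
    (mfderiv (𝓡 n) (𝓡 n) T.transferMap (T.modelFootLift hρ hmR hs w)).toLinearMap
    (mfderiv 𝓘(ℝ, 𝔼 n) (𝓡 n) (T.modelFootLift hρ hmR hs) w).toLinearMap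
  have hprod := fun h => hne (h1.trans h)
  exact (mul_ne_zero_iff.mp hprod).2

/-- **Transfer of the character of a foot**: the lifted foot preserves `(o, ∂oN)` in the level of
`M` iff the model lifted foot preserves `(o, ∂o_model)` in the model level.
[cite: HirschDT1976, §4.4 p. 103] -/
theorem isOrientationPreserving_footLift_iff {ρ : ℝ} (hρ : 0 < ρ) (hmR : m + 2 * ρ ^ 2 ≤ R ^ 2) {s : ℝ}
    (hs : s ^ 2 = 1) (o : Orientation ℝ (𝔼 n) (Fin (finrank ℝ (𝔼 n)))) :
    IsOrientationPreserving (SmoothOrientation.modelSpace o) (T.sublevelOrientation oM).boundary (T.footLift hρ hmR hs) ↔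
      IsOrientationPreserving (SmoothOrientation.modelSpace o) (T.modelOrientation oM).boundary
        (T.modelFootLift hρ hmR hs) := by
  have hfd : MDifferentiable 𝓘(ℝ, 𝔼 n) (𝓡 n) (T.modelFootLift hρ hmR hs) :=
    (T.contMDiff_modelFootLift hρ hmR hs).mdifferentiable (by simp)
  constructor
  · intro h
    rw [T.footLift_eq_comp hρ hmR hs] at h
    exact IsOrientationPreserving.of_comp_left h (T.transferMap_isOrientationPreserving oM)
      T.mdifferentiable_transferMap hfd T.det_mfderiv_transferMap_ne_zero
      (T.det_mfderiv_modelFootLift_ne_zero hρ hmR hs)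
  · intro h
    rw [T.footLift_eq_comp hρ hmR hs]
    exact IsOrientationPreserving.comp_holds (T.transferMap_isOrientationPreserving oM) h
      T.mdifferentiable_transferMap hfd T.det_mfderiv_transferMap_ne_zero
      (T.det_mfderiv_modelFootLift_ne_zero hρ hmR hs)

/-- **The two feet of a `1`-handle have opposite orientation characters in the level below the
handle** (orientation induced from an orientation `oM` of `M`): the `+` foot preserves `(o₀, ∂oN)`
iff the `−` foot preserves `(−o₀, ∂oN)`.  Transferred from the model, where the reflection
`u₀ ↦ −u₀` of the chart ball is an orientation-reversing symmetry of `Q` exchanging the feet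
(`RegularSublevel.levelFoot_isOrientationPreserving_iff_of_symm`). [cite: Kosinski1993, VI (6.6)] -/
theorem footLift_isOrientationPreserving_iff_neg {ρ : ℝ} (hρ : 0 < ρ) (hmR : m + 2 * ρ ^ 2 ≤ R ^ 2)
    (o₀ : Orientation ℝ (𝔼 n) (Fin (finrank ℝ (𝔼 n)))) :
    IsOrientationPreserving (SmoothOrientation.modelSpace o₀) (T.sublevelOrientation oM).boundary
        (T.footLift hρ hmR (one_pow 2)) ↔
      IsOrientationPreserving (SmoothOrientation.modelSpace (-o₀)) (T.sublevelOrientation oM).boundary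
        (T.footLift hρ hmR neg_one_sq) := by
  have hp1 : (1 : ℝ) ^ 2 = 1 := one_pow 2
  have hm1 : (-1 : ℝ) ^ 2 = 1 := neg_one_sq
  rw [T.isOrientationPreserving_footLift_iff oM hρ hmR hp1, T.isOrientationPreserving_footLift_iff oM hρ hmR hm1]
  exact RegularSublevel.levelFoot_isOrientationPreserving_iff_of_symm T.isRegularLevel
    (OneHandleModel.refl n (D.chart.extend (𝓡∂ (n + 1)) p) R) (fun x => OneHandleModel.Q_refl x)
    (OneHandleModel.refl_isOrientationReversing T.hR _)
    (OneHandleModel.contMDiff_footB T.hR T.hm hρ hmR hp1) (OneHandleModel.contMDiff_footB T.hR T.hm hρ hmR hm1)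
    (T.Q_footB hρ hmR hp1) (T.Q_footB hρ hmR hm1)
    (fun w => OneHandleModel.refl_footB T.hR T.hm hρ hmR hp1 w) (fun w => OneHandleModel.refl_footB' T.hR T.hm hρ hmR hp1 w)
    (T.det_mfderiv_modelFootLift_ne_zero hρ hmR hp1) (T.det_mfderiv_modelFootLift_ne_zero hρ hmR hm1) o₀

/-- **Opposite characters for any orientation of a connected level.**  If the level
`∂{f ≤ f p - m}` is connected, then for *every* orientation `oV` of it the `+` foot preserves
`(o₀, oV)` iff the `−` foot preserves `(−o₀, oV)` (`oV = ±∂oN`). [cite: Kosinski1993, VI (6.6)] -/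
theorem footLift_isOrientationPreserving_iff_neg_of_connected (oM : SmoothOrientation (𝓡∂ (n + 1)) M)
    [ConnectedSpace ↥((𝓡∂ (n + 1)).boundary ↥(f ⁻¹' Iic (f p - m)))]
    (oV : SmoothOrientation (𝓡 n) ↥((𝓡∂ (n + 1)).boundary ↥(f ⁻¹' Iic (f p - m))))
    {ρ : ℝ} (hρ : 0 < ρ) (hmR : m + 2 * ρ ^ 2 ≤ R ^ 2) (o₀ : Orientation ℝ (𝔼 n) (Fin (finrank ℝ (𝔼 n)))) :
    IsOrientationPreserving (SmoothOrientation.modelSpace o₀) oV (T.footLift hρ hmR (one_pow 2)) ↔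
      IsOrientationPreserving (SmoothOrientation.modelSpace (-o₀)) oV (T.footLift hρ hmR neg_one_sq) := by
  have hp1 : (1 : ℝ) ^ 2 = 1 := one_pow 2
  have hm1 : (-1 : ℝ) ^ 2 = 1 := neg_one_sq
  rcases SmoothOrientation.eq_or_eq_neg_of_connectedSpace_holds (T.sublevelOrientation oM).boundary oV with h | h
  · rw [h]; exact T.footLift_isOrientationPreserving_iff_neg oM hρ hmR o₀
  · rw [h]
    have L : ∀ (a : Orientation ℝ (𝔼 n) (Fin (finrank ℝ (𝔼 n)))) {s : ℝ} (hs : s ^ 2 = 1),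
        IsOrientationPreserving (SmoothOrientation.modelSpace a) (-(T.sublevelOrientation oM).boundary)
            (T.footLift hρ hmR hs) ↔
          IsOrientationPreserving (SmoothOrientation.modelSpace (-a)) (T.sublevelOrientation oM).boundary
            (T.footLift hρ hmR hs) := by
      intro a s hs
      rw [← SmoothOrientation.neg_modelSpace,
        ← isOrientationPreserving_neg_neg_iff (-SmoothOrientation.modelSpace a) (T.sublevelOrientation oM).boundary,
        neg_neg (SmoothOrientation.modelSpace a)]
    rw [L o₀ hp1, L (-o₀) hm1]
    exact T.footLift_isOrientationPreserving_iff_neg oM hρ hmR (-o₀)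

end TransferData

end HandleChart

end Literature.Topology.FourManifolds

end
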